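import Summits.QuantumFields.YangMills.Theorems.BalabanUVNodesK1AxV11Defs
import Summits.QuantumFields.YangMills.Theorems.BalabanUVNodesK0RecordFormatNamesLemmas16

/-!
# K1ᴬ (stmt-QuantumFields-27239 `StabilityBRunRowsAtRecordR13SepCoPHVAx`) — THE v11.2 MIRROR, ROUTE-INDEPENDENT HALF: the LETTERS rungs `RunRowsLettersAtSomeRecord13PWS(VW)`, the texts
# `Stub3LText(VW)` of the re-cut stubs `stub_letters13(VW)`, the kernel-checked bridges back to v11.1's stub-3 texts, and the ∀θ per-radius DOORS to the new texts
# (the by-name K1ᴬ concluders, which read the route decl, are the Theses-cone sequel `…K1AxV11LettersByName`)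

Cell `pub-ymgap` (YM-PLAN Track A, D-0062), seat `pub-ymgap-dag-n24-c` (g25; the `-a` knit-by-name hand of LINE 2′; ★ P3 g91 №14∕№15 «ONE filer for the K1Ax named doors = dag-n24-c»;
ref-Q g15 READS-114 «the two expected successors»).  `--kind definition --supports stmt-QuantumFields-27239 --as helper`; COUNT-NEUTRAL; no `sorry`, no `instance`, no `notation`;
standard axioms; imports `…K1AxV11Defs` + `…K0RecordFormatNamesLemmas16` only (NO module that imports the route file — `lint.theses-cone`).  The Theses-free twin of what ✦ plan g102 REGISTERED on ⟨27239⟩ at 2026-08-31T11:40:44Z as skeleton v11.2 `pub-ymgap-plan/D102-K1V112/K1Skeleton13SepCoPHAxV11_2.lean`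
sha256 2c0c0eed585a0c47… (★★★ director-ym g22 №568 (2); ◆ CRIT-1 g37 J-READ STAMP PASS O.5302): six stubs `stub_nodes13PWS` · `stub_runRows13PWS` · `stub_letters13` · `stub_nodes13PWSVW` ·
`stub_runRows13PWSVW` · `stub_letters13VW` (0∕6); v11.1's `stub_cont13(VW)` RETIRED unproved, their texts recovered by the bridges.  Sequel of g23∕g24's v11 mirror trio
✓`…K1AxV11Defs` ∕ ✓`…K1AxV11Roads` ∕ ✓`…K1AxV11StubTexts` (every v11.1 text BYTE-KEPT by v11.2, so those three files serve unchanged).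

WHAT THIS FILE IS (mirror = the kit's NEW declarations with bodies COPIED VERBATIM, so that by-name producers under `Theorems/` can state the registered texts without importing a `Cruxes/` file):
* §1 (namespace `…Theorems.K1AxV11Defs`, the v11 mirror's): `RunRowsLettersAtSomeRecord13PWS` (kit :329) ∕ `RunRowsLettersAtSomeRecord13PWSVW` (kit :569) — rung 2″ ∕ 2ⱽᵂ body ∧
  `∃ γ, γ₀ ≤ γ ∧ γ ≤ θ.γ ∧ K0RecordFormatNames.PolLimitLocUnifOnBox₁₃Ax F 2 θ.toStage13Params γ ∧ (∃ C δ₁, …PlimDecayOnBox₁₃Ax … γ C δ₁) ∧ …PvolHistContOnBox₁₃Ax … γ` (★★ DEF-1 g37's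
  ED.25 tree names ✓p821177, AT THE ONE witness tuple); the BRIDGES `stubCont13_of_letters13` (kit :359) ∕ `stubCont13VW_of_letters13VW` (kit :590) VERBATIM — one `obtain` + DEF-1's
  ★★`K0RecordFormatNames.survCont_betaOfRecord₁₃Ax_of_letters₁₃Ax` (✓p821395 `…Lemmas16`, over ★ PTB-1 g6's kernel ✓p820605).
* §2 (namespace `…Theorems.K1AxV11StubTexts`, the v11 mirror's): the NEW stub texts `Stub3LText` ∕ `Stub3LTextVW` (`:= ∀ F, RunRowsAtSomeRecord13PWS(VW) F → RunRowsLettersAtSomeRecord13PWS(VW) F`,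
  = `stub_letters13(VW)`'s signatures) and the bridges read at those names (`stubCont13(VW)_text_of_stub3LText(VW)`, conclusions = ✓`Stub3Text(VW)` unfolded).  The by-name K1ᴬ
  concluders from `(Stub1TextVW, Stub2TextVW, Stub3LTextVW)` read the route decl and therefore live in the sequel `…K1AxV11LettersByName` (imports the route file directly).
* §3 (namespace `…Theorems.K1AxStubCont13DoorOfKernelLetters`, this seat's doors'): ★★★ `stubLetters13VW_of_letters₁₃AxAtRadius` ∕ `stubLetters13_of_letters₁₃AxAtRadius` — the ∀θ PER-RADIUS
  NAMED letters `∀ F θ, Provisos₁₃SepCoPHAx → (ZhUnity ∧ SlotsNondegenerate₁₃Ax) → Admissible → ∃ γc, 0 < γc ∧ γc ≤ θ.γ ∧ PolLimitLocUnifOnBox₁₃Ax … γc ∧ (∃ C δ₁, PlimDecayOnBox₁₃Ax … γc C δ₁)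
  ∧ PvolHistContOnBox₁₃Ax … γc` (the hypothesis of ✓p821568's `stubCont13VW_of_letters₁₃AxAtRadius`, the ∀θ supplier door of record named in the kit's STUB 3ⱽᵂᴸ docstring) ⟹ THE
  REGISTERED TEXTS of `stub_letters13VW` ∕ `stub_letters13` (rows witness KEPT; rows level cut `γ₀ ↦ min γ₀ γc` by `RunConstRemainder.mono` + prefix-interval shrink; `γ := γc`) — the
  «middle kit» ref-Q READS-114 found absent; with the bridges it re-derives ✓p821568's doors, so the v11.2 chain reads ∀θ-letters ⟹ `stub_letters13VW` text ⟹ `stub_cont13VW` text ⟹ K1ᴬ.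

HONEST FRAMING (binding).  Definitions (hypothesis shapes) + kernel-checked bookkeeping; the three letters are HYPOTHESES inhabited nowhere ((T-β1)(T-β2) = [I] (1.21)∕(5.10)
small-coupling content at the record, (T-β3) the finite-volume item); no registered stub is closed by this file (v11.2 0∕6); K1ᴬ stmt-QuantumFields-27239 OPEN; K0ᴬ ∕ K3ᴬ OPEN; COUNT
8∕27 (A 8∕28) · K 1∕4 UNMOVED; R4 = the conditional finite-𝕋⁴ rung `BalabanLadder.UV` at fixed `ε = L^(−K)` only — NOT continuum ∕ ℝ⁴ ∕ OS; the Yang–Mills mass gap (Clay) is NOT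
proved by any of this.
-/

noncomputable section

/-! ## §1  The LETTERS rungs and the bridges (kit v11.2 :329 ∕ :569 ∕ :359 ∕ :590, bodies VERBATIM) -/

namespace Summit.QuantumFields.YangMills.Theorems.K1AxV11Defs

open Literature.MathematicalPhysics.QuantumFieldTheory.Balaban1983to89
open Literature.MathematicalPhysics.QuantumFieldTheory.Balaban1983to89.T4Continuum
open Literature.MathematicalPhysics.QuantumFieldTheory.Balaban1983to89.DagBinding

section RunRows

open FlowStepRuns
open FlowStep (HBeta RGEqH prefixOf)
open Summit.QuantumFields.YangMills.Theorems.BalabanUVNodesK2NamedJetsRunRemAt (RunConstRemainder SurvCont)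

/-- **rung 2‴ᴸ (v11.2, RUN CURRENCY + THE THREE (ℓ1) LETTERS BY NAME; the BOX ROAD at K1's witness)** — kit :329 VERBATIM: rung 2″'s text (`RunRowsAtSomeRecord13PWS F`) with ONE
more conjunct — on SOME box side `γ` with `γ₀ ≤ γ ≤ θ.γ`, AT THE SAME witness tuple `θ` (its Stage-13 view `θ.toStage13Params`, `N = 2`): (T-β1) `K0RecordFormatNames.PolLimitLocUnifOnBox₁₃Ax`
(the windowed finite-volume kernels of the record's re-centred merged term family converge locally uniformly in the history on the box `]0, γ]^{k+1}`), (T-β2)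
`K0RecordFormatNames.PlimDecayOnBox₁₃Ax … γ C δ₁` for SOME `(C, δ₁)` ((5.10) for the limit kernel at every box history), (T-β3) `K0RecordFormatNames.PvolHistContOnBox₁₃Ax`
(history-continuity of the finite-volume kernels) — ★★ DEF-1 g37's ED.25 TREE NAMES, displayed BY NAME.  `b r γ₀ B M γ C δ₁` free (∃-side).  HYPOTHESIS SHAPES of [I] §1∕§5 content at ONE
tuple; asserts nothing. [cite: Balaban1987RG1, Thm 1 p.259, Thm 3 p.264, (1.7) p.261, (1.20)–(1.22) p.264, p.263, (5.10) p.293; Balaban1988RG2Cluster, (2.41) p.21 (statement shape only)] -/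
def RunRowsLettersAtSomeRecord13PWS (F : T4Family) : Prop :=
  ∃ (θ : Node00.Stage13HParams F 2) (h : θ.Provisos₁₃SepCoPHAx F 2) (w : WorldP), (θ.ZhUnity F 2 ∧ θ.SlotsNondegenerate₁₃Ax F 2) ∧ θ.Admissible F 2 ∧
    RecordS F θ h w ∧ (∀ P : B12.RunParams, Nodes (leavesP w P)) ∧
    ∃ (b : ℕ → ℝ) (r γ₀ B M : ℝ), 0 < γ₀ ∧ RunConstRemainder (Node00.betaOfRecord₁₃Ax F 2 θ.toStage13Params) b r γ₀ ∧ (∀ k, b k ≤ B) ∧ B + r ≤ w.βup ∧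
      (∀ (n : ℕ) (gs : ℕ → ℝ), RGEqH n (Node00.betaOfRecord₁₃Ax F 2 θ.toStage13Params) gs → Step.InInterval γ₀ n gs →
        ∀ k, k ≤ n → -M ≤ ∑ j ∈ Finset.Ico k n, Node00.betaOfRecord₁₃Ax F 2 θ.toStage13Params j (prefixOf gs j)) ∧
      ∃ γ : ℝ, γ₀ ≤ γ ∧ γ ≤ θ.γ ∧
        Summit.QuantumFields.YangMills.Theorems.K0RecordFormatNames.PolLimitLocUnifOnBox₁₃Ax F 2 θ.toStage13Params γ ∧
        (∃ C δ₁ : ℝ, Summit.QuantumFields.YangMills.Theorems.K0RecordFormatNames.PlimDecayOnBox₁₃Ax F 2 θ.toStage13Params γ C δ₁) ∧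
        Summit.QuantumFields.YangMills.Theorems.K0RecordFormatNames.PvolHistContOnBox₁₃Ax F 2 θ.toStage13Params γ

/-- **STUB 3's v11.1 TEXT (`RunRowsContAtSomeRecord13PWS`, = ✓`K1AxV11StubTexts.Stub3Text`'s conclusion) FROM THE LETTERS RUNG — kit :359 VERBATIM, kernel-checked**: at the letters
witness keep everything and read (C) `SurvCont β_θ γ₀` off DEF-1 g37's ★★`K0RecordFormatNames.survCont_betaOfRecord₁₃Ax_of_letters₁₃Ax` at `0 < γ₀ ≤ γ ≤ θ.γ`.
[cite: Balaban1987RG1, §1 pp.263–264, (1.20)–(1.22) p.264, (5.10) p.293] -/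
theorem stubCont13_of_letters13 (hL : ∀ F : T4Family, RunRowsAtSomeRecord13PWS F → RunRowsLettersAtSomeRecord13PWS F) :
    ∀ F : T4Family, RunRowsAtSomeRecord13PWS F → RunRowsContAtSomeRecord13PWS F := by
  intro F hrows
  obtain ⟨θ, h, w, hU, hθ, hR, hnodes, b, r, γ₀, B, M, hγ₀, hrem, hB, hmatch, hps, γ, hle, hγ, h1, ⟨C, δ₁, h2⟩, h3⟩ := hL F hrows
  exact ⟨θ, h, w, hU, hθ, hR, hnodes, b, r, γ₀, B, M, hγ₀, hrem, hB, hmatch, hps,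
    Summit.QuantumFields.YangMills.Theorems.K0RecordFormatNames.survCont_betaOfRecord₁₃Ax_of_letters₁₃Ax θ.toStage13Params hγ₀ hle hγ h1 h2 h3⟩

/-- **rung 2ⱽᵂ‴ᴸ (LINE 2′, v11.2) — kit :569 VERBATIM**: rung 2ⱽᵂ's text with the same letters conjunct (θ-level, version-free). [cite: Balaban1987RG1, Thm 1 p.259, (1.7) p.261,
(1.20)–(1.22) p.264, p.263, (5.10) p.293 (statement shapes)] -/
def RunRowsLettersAtSomeRecord13PWSVW (F : T4Family) : Prop :=
  ∃ (θ : Node00.Stage13HParams F 2) (h : θ.Provisos₁₃SepCoPHAx F 2) (v : Node00.Revision₁₃Ax F 2 θ h) (w : WorldP), (θ.ZhUnity F 2 ∧ θ.SlotsNondegenerate₁₃Ax F 2) ∧ θ.Admissible F 2 ∧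
    RecordSV F θ h v w ∧ (∀ P : B12.RunParams, (leavesP w P).smallCouplings → Nodes (leavesP w P)) ∧
    ∃ (b : ℕ → ℝ) (r γ₀ B M : ℝ), 0 < γ₀ ∧ RunConstRemainder (Node00.betaOfRecord₁₃Ax F 2 θ.toStage13Params) b r γ₀ ∧ (∀ k, b k ≤ B) ∧ B + r ≤ w.βup ∧
      (∀ (n : ℕ) (gs : ℕ → ℝ), RGEqH n (Node00.betaOfRecord₁₃Ax F 2 θ.toStage13Params) gs → Step.InInterval γ₀ n gs →
        ∀ k, k ≤ n → -M ≤ ∑ j ∈ Finset.Ico k n, Node00.betaOfRecord₁₃Ax F 2 θ.toStage13Params j (prefixOf gs j)) ∧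
      ∃ γ : ℝ, γ₀ ≤ γ ∧ γ ≤ θ.γ ∧
        Summit.QuantumFields.YangMills.Theorems.K0RecordFormatNames.PolLimitLocUnifOnBox₁₃Ax F 2 θ.toStage13Params γ ∧
        (∃ C δ₁ : ℝ, Summit.QuantumFields.YangMills.Theorems.K0RecordFormatNames.PlimDecayOnBox₁₃Ax F 2 θ.toStage13Params γ C δ₁) ∧
        Summit.QuantumFields.YangMills.Theorems.K0RecordFormatNames.PvolHistContOnBox₁₃Ax F 2 θ.toStage13Params γ

/-- **STUB 3ⱽᵂ's v11.1 TEXT (`RunRowsContAtSomeRecord13PWSVW`, = ✓`K1AxV11StubTexts.Stub3TextVW`'s conclusion) FROM THE LETTERS RUNG — kit :590 VERBATIM, kernel-checked.**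
[cite: Balaban1987RG1, §1 pp.263–264, (1.20)–(1.22) p.264, (5.10) p.293] -/
theorem stubCont13VW_of_letters13VW (hL : ∀ F : T4Family, RunRowsAtSomeRecord13PWSVW F → RunRowsLettersAtSomeRecord13PWSVW F) :
    ∀ F : T4Family, RunRowsAtSomeRecord13PWSVW F → RunRowsContAtSomeRecord13PWSVW F := by
  intro F hrows
  obtain ⟨θ, h, v, w, hU, hθ, hR, hnodes, b, r, γ₀, B, M, hγ₀, hrem, hB, hmatch, hps, γ, hle, hγ, h1, ⟨C, δ₁, h2⟩, h3⟩ := hL F hrows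
  exact ⟨θ, h, v, w, hU, hθ, hR, hnodes, b, r, γ₀, B, M, hγ₀, hrem, hB, hmatch, hps,
    Summit.QuantumFields.YangMills.Theorems.K0RecordFormatNames.survCont_betaOfRecord₁₃Ax_of_letters₁₃Ax θ.toStage13Params hγ₀ hle hγ h1 h2 h3⟩

/-- LINE 1's letters rung feeds LINE 2′'s (the `refl` revision and the window guard, as for the other rungs: `recordSV_refl_iff`, nodes kept on every run). -/
theorem runRowsLettersAtSomeRecord13PWSVW_of_line1 {F : T4Family} (hN : RunRowsLettersAtSomeRecord13PWS F) : RunRowsLettersAtSomeRecord13PWSVW F := by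
  obtain ⟨θ, h, w, hU, hθ, hR, hnodes, b, r, γ₀, B, M, hγ₀, hrem, hB, hmatch, hps, hL⟩ := hN
  exact ⟨θ, h, Node00.Revision₁₃Ax.refl F 2 θ h, w, hU, hθ, (recordSV_refl_iff θ h w).2 hR, fun P _ => hnodes P, b, r, γ₀, B, M, hγ₀, hrem, hB, hmatch, hps, hL⟩

end RunRows

end Summit.QuantumFields.YangMills.Theorems.K1AxV11Defs

/-! ## §2  The NEW stub texts (v11.2 `stub_letters13VW` ∕ `stub_letters13` signatures as named `Prop`s, next to g24's `Stub1∕2∕3Text(VW)`) -/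

namespace Summit.QuantumFields.YangMills.Theorems.K1AxV11StubTexts

open Literature.MathematicalPhysics.QuantumFieldTheory.Balaban1983to89.T4Continuum
open Summit.QuantumFields.YangMills.Theorems.K1AxV11Defs

/-- **STUB 3ⱽᵂᴸ's TEXT** (v11.2 kit :585 `stub_letters13VW`, L): the rows witness (kept or re-chosen, `γ₀` shrinkable) PLUS the three (ℓ1) β-kernel letters at its tuple on some box
`γ₀ ≤ γ ≤ θ.γ`. (Balaban1987RG1, Thm 1 p.259, (1.7) p.261, (1.20)–(1.22) p.264, p.263, (5.10) p.293 (statement shapes); bookkeeping) -/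
def Stub3LTextVW : Prop := ∀ F : T4Family, RunRowsAtSomeRecord13PWSVW F → RunRowsLettersAtSomeRecord13PWSVW F

/-- **STUB 3ᴸ's TEXT** (v11.2 kit :351 `stub_letters13`, L; LINE 1). (Balaban1987RG1, Thm 1 p.259, (1.7) p.261, (1.20)–(1.22) p.264, (5.10) p.293 (statement shapes); bookkeeping) -/
def Stub3LText : Prop := ∀ F : T4Family, RunRowsAtSomeRecord13PWS F → RunRowsLettersAtSomeRecord13PWS F

/-- STUB 3ⱽᵂᴸ's text ⟹ STUB 3ⱽᵂ's v11.1 text (the kit bridge, read at the new text name; = ✓`K1AxV11StubTexts.Stub3TextVW` unfolded — that name lives in the Theses-cone file, so it is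
spelled here). [cite: Balaban1987RG1, §1 pp.263–264 (bookkeeping)] -/
theorem stubCont13VW_text_of_stub3LTextVW (h : Stub3LTextVW) : ∀ F : T4Family, RunRowsAtSomeRecord13PWSVW F → RunRowsContAtSomeRecord13PWSVW F :=
  stubCont13VW_of_letters13VW h

/-- STUB 3ᴸ's text ⟹ STUB 3's v11.1 text (LINE 1; = ✓`K1AxV11StubTexts.Stub3Text` unfolded). [cite: Balaban1987RG1, §1 pp.263–264 (bookkeeping)] -/
theorem stubCont13_text_of_stub3LText (h : Stub3LText) : ∀ F : T4Family, RunRowsAtSomeRecord13PWS F → RunRowsContAtSomeRecord13PWS F :=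
  stubCont13_of_letters13 h

end Summit.QuantumFields.YangMills.Theorems.K1AxV11StubTexts

/-! ## §3  THE ∀θ PER-RADIUS DOORS TO THE NEW TEXTS (the «middle kit»: named letters at every rung-0 tuple on a per-tuple small box ⟹ `stub_letters13VW` ∕ `stub_letters13` texts) -/

namespace Summit.QuantumFields.YangMills.Theorems.K1AxStubCont13DoorOfKernelLetters

open Literature.MathematicalPhysics.QuantumFieldTheory.Balaban1983to89
open Literature.MathematicalPhysics.QuantumFieldTheory.Balaban1983to89.T4Continuum (T4Family)
open Summit.QuantumFields.YangMills.Theorems.K0RecordFormatNames (PolLimitLocUnifOnBox₁₃Ax PlimDecayOnBox₁₃Ax PvolHistContOnBox₁₃Ax)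
open Summit.QuantumFields.YangMills.Theorems.BalabanUVNodesK2NamedJetsRunRemAt (RunConstRemainder.mono)
open Summit.QuantumFields.YangMills.Theorems.K1AxV11Defs (RunRowsAtSomeRecord13PWSVW RunRowsLettersAtSomeRecord13PWSVW RunRowsAtSomeRecord13PWS RunRowsLettersAtSomeRecord13PWS)
open Summit.QuantumFields.YangMills.Theorems.K1AxV11StubTexts (Stub3LTextVW Stub3LText)

/-- ★★★ **THE REGISTERED TEXT OF `stub_letters13VW` (v11.2) FROM THE THREE NAMED LETTERS ON A PER-θ SMALL BOX at every rung-0 tuple** (the hypothesis of ✓p821568's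
`stubCont13VW_of_letters₁₃AxAtRadius` — the ∀θ supplier door of record named in the kit's STUB 3ⱽᵂᴸ docstring): keep the rows witness `(θ, h, v, w)`, read `γc` at its `θ`, cut the rows
level to `min γ₀ γc` (`RunConstRemainder.mono`; the floor only shrinks the interval) and put `γ := γc` (`min γ₀ γc ≤ γc ≤ θ.γ`).  CONDITIONAL — the stub stays OPEN until the letters
are proved. [cite: Balaban1987RG1, Thm 1 p.259, Thm 3 p.264, (1.7) p.261, (1.20)–(1.22) p.264, (5.10) p.293] -/
theorem stubLetters13VW_of_letters₁₃AxAtRadius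
    (H : ∀ (F : T4Family) (θ : Node00.Stage13HParams F 2), θ.Provisos₁₃SepCoPHAx F 2 → (θ.ZhUnity F 2 ∧ θ.SlotsNondegenerate₁₃Ax F 2) → θ.Admissible F 2 →
      ∃ γc : ℝ, 0 < γc ∧ γc ≤ θ.γ ∧ PolLimitLocUnifOnBox₁₃Ax F 2 θ.toStage13Params γc ∧ (∃ C δ₁ : ℝ, PlimDecayOnBox₁₃Ax F 2 θ.toStage13Params γc C δ₁) ∧
        PvolHistContOnBox₁₃Ax F 2 θ.toStage13Params γc) :
    Stub3LTextVW := by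
  intro F hrows
  obtain ⟨θ, h, v, w, hU, hθ, hR, hnodes, b, r, γ₀, B, M, hγ₀, hrem, hB, hmatch, hps⟩ := hrows
  obtain ⟨γc, hγc, hγcle, h1, h2, h3⟩ := H F θ h hU hθ
  refine ⟨θ, h, v, w, hU, hθ, hR, hnodes, b, r, min γ₀ γc, B, M, lt_min hγ₀ hγc, hrem.mono (min_le_left _ _), hB, hmatch, ?_,
    γc, min_le_right _ _, hγcle, h1, h2, h3⟩
  intro n gs hrg hI k hk
  exact hps n gs hrg (fun j hj => ⟨(hI j hj).1, (hI j hj).2.trans (min_le_left _ _)⟩) k hk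

/-- ★★★ **THE REGISTERED TEXT OF LINE 1's `stub_letters13` (v11.2) FROM THE THREE NAMED LETTERS ON A PER-θ SMALL BOX** (same kit at `RunRowsAtSomeRecord13PWS`).  CONDITIONAL.
[cite: Balaban1987RG1, Thm 1 p.259, Thm 3 p.264, (1.7) p.261, (1.20)–(1.22) p.264, (5.10) p.293] -/
theorem stubLetters13_of_letters₁₃AxAtRadius
    (H : ∀ (F : T4Family) (θ : Node00.Stage13HParams F 2), θ.Provisos₁₃SepCoPHAx F 2 → (θ.ZhUnity F 2 ∧ θ.SlotsNondegenerate₁₃Ax F 2) → θ.Admissible F 2 →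
      ∃ γc : ℝ, 0 < γc ∧ γc ≤ θ.γ ∧ PolLimitLocUnifOnBox₁₃Ax F 2 θ.toStage13Params γc ∧ (∃ C δ₁ : ℝ, PlimDecayOnBox₁₃Ax F 2 θ.toStage13Params γc C δ₁) ∧
        PvolHistContOnBox₁₃Ax F 2 θ.toStage13Params γc) :
    Stub3LText := by
  intro F hrows
  obtain ⟨θ, h, w, hU, hθ, hR, hnodes, b, r, γ₀, B, M, hγ₀, hrem, hB, hmatch, hps⟩ := hrows
  obtain ⟨γc, hγc, hγcle, h1, h2, h3⟩ := H F θ h hU hθ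
  refine ⟨θ, h, w, hU, hθ, hR, hnodes, b, r, min γ₀ γc, B, M, lt_min hγ₀ hγc, hrem.mono (min_le_left _ _), hB, hmatch, ?_,
    γc, min_le_right _ _, hγcle, h1, h2, h3⟩
  intro n gs hrg hI k hk
  exact hps n gs hrg (fun j hj => ⟨(hI j hj).1, (hI j hj).2.trans (min_le_left _ _)⟩) k hk

end Summit.QuantumFields.YangMills.Theorems.K1AxStubCont13DoorOfKernelLetters

end
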